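import Summits.QuantumFields.BalabanUV.T4Continuum.Support.ScalarAveragedPropagator

/-!
# `BalabanUV.Beta.GAN24.DirichletBoxRegularity` — binder row G-an2-4 / (CONV-C), road P2 PART II («Dirichlet, explicit rate»,
# the fine-lattice constituent on REGIONS), module M-R: DISCRETE `H²` REGULARITY OF THE COMPRESSED LATTICE LAPLACIAN ON
# CORNER-FREE REGIONS (every coordinate-product set, in particular every box of unit blocks) — the one region-specific input of the
# Dirichlet two-level law (unit b2b-balaban-gan24-p2, gen 22, v1)

HONEST FRAMING (cell contract, verbatim): «discharging `BetaPertH` makes Bałaban's UV stability UNCONDITIONAL — a real constructive-QFT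
result; it is NOT the continuum limit and NOT the Clay problem.»  This module is a SUPPLIER item under the T⁴-DAG sub-row
`T4-U1a.S-NE2-D1-DIRICHLET°` (holder: the t4-ne2-p1 lineage; its displayed wall `hinj` = the injected two-level law of the `Ω`-restricted
`U = 1` free tower, [Balaban1985BackgroundPropagators] p. 394 «the operator Δ^η_U↾Ω₀ is the covariant Laplace operator with Dirichlet
boundary conditions on Ω₀ᶜ … Δ′_a↾Ω₀ = Ω₀Δ′_aΩ₀»).  Road P2's kernel route to that law (memo `HOME/b2b-balaban-gan24-p2/gen22/
DIRICHLET-BOX-TWOLEVEL.md`, steps L1–L6) needs exactly ONE region-specific estimate, L5: for a lattice field `z` supported in `Ω`, the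
INTERIOR diagonal second differences are controlled by the COMPRESSED Laplacian, `Σ_μ Σ_{x∈Ω} |(∂_μᴴ∂_μ z)(x)|² ≤ Σ_{x∈Ω} |(Δz)(x)|²`.
This file proves it, with equality up to a displayed sum of squares, for every CORNER-FREE `Ω` — a purely combinatorial condition
(«no exterior site is adjacent to `Ω` in two different directions») satisfied by every COORDINATE-PRODUCT subset of the torus (boxes of
unit blocks, slabs, wrapping or not) — and records where it fails (re-entrant edges), which is the located obstruction for general unions
of blocks (the holder's «discrete elliptic regularity up to ∂Ω», [B9] p. 394, reduced to one inequality).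

ABSOLUTE RULE (cell, verbatim): «No internally-minted statement may enter as a cited fact. Every hypothesis is either kernel-proved in this
package or a verbatim quotation of a PUBLISHED theorem with page reference. The manuscript(s) under audit are NOT citable for their own
disputed steps — they are the thing under adjudication; programme-internal (2001/route/tribunal) claims are never citable.»  Everything
below is [folklore] finite summation by parts on the tree's typed torus objects (`B5Action121.sdiff/LapS`); nothing printed is a hypothesis.

## What this file proves (0 sorry; Mathlib + the tree's scalar torus calculus BY NAME)

* §1 `Pdir N c μ = ∂_μᴴ∂_μ` (so `LapS = Σ_μ Pdir`), its stencil `(P_μ f)(x) = c̄c(2f(x) − f(x+e_μ) − f(x−e_μ))`, and the exact torus identity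
  `⟨P_μ z, P_ν z⟩ = ‖∂_μ∂_ν z‖²` (commuting normal difference operators).
* §2 `SuppIn Ω z` (support in `Ω`), **`CornerFree Ω`**, and the vanishing lemma: for `z ⊂ Ω`, `x ∉ Ω`, `μ ≠ ν`:
  `conj((P_μ z)(x))·(P_ν z)(x) = 0` (an exterior site that sees `Ω` in direction `μ` sees nothing of it in direction `ν`).
* §3 **`sum_normSq_LapS_eq`**: for corner-free `Ω` and `z ⊂ Ω`,
  `Σ_{x∈Ω}|(Δz)(x)|² = Σ_μ Σ_{x∈Ω}|(P_μz)(x)|² + Σ_μ Σ_{ν≠μ} ‖∂_μ∂_νz‖²`, hence **`hdiag_le_sum_normSq_LapS`**: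
  `Hdiag Ω z := Σ_μ Σ_{x∈Ω}|(P_μ z)(x)|² ≤ Σ_{x∈Ω}|(Δz)(x)|²` — discrete `H²` regularity with constant `1`, uniform in the lattice
  factor `c` (= `η⁻¹`) and in the torus.
* §4 **`cornerFree_prodSet`**: every coordinate-product set `{x | ∀ μ, x_μ ∈ S_μ}` is corner-free (membership is coordinatewise; no
  interval structure, no non-wrapping condition needed); in particular boxes of unit blocks at every level of the tower.

LOCATED (prose, not a theorem): at a RE-ENTRANT edge of a general union of blocks the exterior corner site `x ∉ Ω` has `x − e_μ ∈ Ω`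
AND `x − e_ν ∈ Ω`; then `(P_μz)(x) = −c̄c·z(x−e_μ)`, `(P_νz)(x) = −c̄c·z(x−e_ν)` and the cross term of §2 does NOT vanish — the identity
of §3 acquires a boundary term of indefinite sign supported on re-entrant edges.  The two-level law for such `Ω` is therefore stated
(module M-E) CONDITIONAL on the displayed binder `Hdiag Ω z ≤ κ²·Σ_{x∈Ω}|(Δz)(x)|²`, proved here with `κ = 1` for corner-free `Ω`.

NOT CLAIMED: anything about NE2, about the torus rates of `G_k`/`H_k` (t4-ne2 lineage), about (CONV-C) as a whole, `BetaPertH`,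
continuum, Clay.  `U = 1`, scalar layer, finite torus; «not in print; our proof attempt».  HONEST DEPENDENCY: continuum YM on T⁴ ⇐
BetaPertH ∧ nine spine estimates (0/9 proved); BetaPertH ⇐ (D1) ∧ (D4) ∧ CAP+tail; G-an2-4 gates asym, D1 and NE2/3/4.
-/

noncomputable section

open scoped BigOperators ComplexConjugate Matrix
open Finset

namespace Summit.QuantumFields.BalabanUV.Beta.GAN24.DirichletBoxRegularity

open Literature.MathematicalPhysics.QuantumFieldTheory.Balaban1983to89.B5Prop11Plancherel (Tor unitVec)
open Literature.MathematicalPhysics.QuantumFieldTheory.Balaban1983to89.B5Action121 (sdiff LapS sdiff_mulVec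
  sdiff_conjTranspose_mulVec sdiff_sdiff_comm sdiffH_sdiff_comm star_mulVec_dotProduct
  dotProduct_mulVec_eq_star_conjTranspose_mulVec)
open Literature.MathematicalPhysics.QuantumFieldTheory.Balaban1983to89.B5Prop11Lower (nsq nsq_nonneg star_dotProduct_self)

variable {d : ℕ} (N : Fin d → ℕ) [hN : ∀ μ, NeZero (N μ)]

/-! ## §1 The diagonal second-difference operators `P_μ = ∂_μᴴ∂_μ` -/

/-- the diagonal second-difference operator in direction `μ`: `P_μ = ∂_μᴴ ∂_μ` (`LapS = Σ_μ P_μ`). [folklore] -/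
def Pdir (c : ℂ) (μ : Fin d) : Matrix (Tor N) (Tor N) ℂ := (sdiff N c μ)ᴴ * sdiff N c μ

/-- `Δ = Σ_μ P_μ` (definitional). [folklore] -/
theorem LapS_eq_sum_Pdir (c : ℂ) : LapS N c = ∑ μ, Pdir N c μ := rfl

/-- the stencil: `(P_μ f)(x) = c̄c·(2f(x) − f(x+e_μ) − f(x−e_μ))`. [folklore] -/
theorem Pdir_mulVec (c : ℂ) (μ : Fin d) (f : Tor N → ℂ) (x : Tor N) :
    (Pdir N c μ *ᵥ f) x = conj c * c * (2 * f x - f (x + unitVec N μ) - f (x - unitVec N μ)) := by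
  simp only [Pdir, ← Matrix.mulVec_mulVec, sdiff_conjTranspose_mulVec, sdiff_mulVec, sub_add_cancel]
  ring

/-- `(Δ f)(x) = Σ_μ (P_μ f)(x)`. [folklore] -/
theorem LapS_mulVec_eq_sum (c : ℂ) (f : Tor N → ℂ) (x : Tor N) :
    (LapS N c *ᵥ f) x = ∑ μ, (Pdir N c μ *ᵥ f) x := by
  rw [LapS_eq_sum_Pdir, Matrix.sum_mulVec, Finset.sum_apply]

/-- **the torus cross identity** `⟨P_μ z, P_ν z⟩ = ‖∂_μ∂_ν z‖²` (the difference operators are commuting and normal). [folklore] -/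
theorem star_Pdir_dotProduct_Pdir (c : ℂ) (μ ν : Fin d) (z : Tor N → ℂ) :
    star (Pdir N c μ *ᵥ z) ⬝ᵥ (Pdir N c ν *ᵥ z) = ((nsq (sdiff N c μ *ᵥ (sdiff N c ν *ᵥ z)) : ℝ) : ℂ) := by
  simp only [Pdir, ← Matrix.mulVec_mulVec]
  rw [star_mulVec_dotProduct, Matrix.conjTranspose_conjTranspose, ← sdiffH_sdiff_comm,
    dotProduct_mulVec_eq_star_conjTranspose_mulVec, Matrix.conjTranspose_conjTranspose, sdiff_sdiff_comm,
    star_dotProduct_self]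

/-! ## §2 Supports and corner-free regions -/

/-- [shape] `z` is supported in `Ω` (vanishes off `Ω`). [folklore] -/
def SuppIn (Ω : Finset (Tor N)) (z : Tor N → ℂ) : Prop := ∀ x, x ∉ Ω → z x = 0

/-- [shape] **CORNER-FREE region**: an exterior site adjacent to `Ω` in direction `μ` is not adjacent to `Ω` in any other direction `ν`
(«no re-entrant edges»; every coordinate-product set is corner-free, §4). [folklore] -/
def CornerFree (Ω : Finset (Tor N)) : Prop :=
  ∀ x, x ∉ Ω → ∀ μ ν : Fin d, μ ≠ ν → (x + unitVec N μ ∈ Ω ∨ x - unitVec N μ ∈ Ω) →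
    (x + unitVec N ν ∉ Ω ∧ x - unitVec N ν ∉ Ω)

variable {N}

/-- an exterior site none of whose `μ`-neighbours is in `Ω` carries no `P_μ z`. [folklore] -/
theorem Pdir_mulVec_eq_zero_of_not_mem {Ω : Finset (Tor N)} {z : Tor N → ℂ} (hz : SuppIn N Ω z) (c : ℂ) {μ : Fin d}
    {x : Tor N} (hx : x ∉ Ω) (hp : x + unitVec N μ ∉ Ω) (hm : x - unitVec N μ ∉ Ω) : (Pdir N c μ *ᵥ z) x = 0 := by
  rw [Pdir_mulVec, hz x hx, hz _ hp, hz _ hm]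
  ring

/-- **the vanishing lemma**: on a corner-free region, at an exterior site the cross term of two different directions vanishes. [folklore] -/
theorem cross_eq_zero_of_not_mem {Ω : Finset (Tor N)} (hΩ : CornerFree N Ω) {z : Tor N → ℂ} (hz : SuppIn N Ω z) (c : ℂ)
    {μ ν : Fin d} (hμν : μ ≠ ν) {x : Tor N} (hx : x ∉ Ω) :
    conj ((Pdir N c μ *ᵥ z) x) * (Pdir N c ν *ᵥ z) x = 0 := by
  by_cases h : x + unitVec N μ ∈ Ω ∨ x - unitVec N μ ∈ Ω
  · obtain ⟨hp, hm⟩ := hΩ x hx μ ν hμν h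
    rw [Pdir_mulVec_eq_zero_of_not_mem hz c hx hp hm, mul_zero]
  · obtain ⟨hp, hm⟩ := not_or.mp h
    rw [Pdir_mulVec_eq_zero_of_not_mem hz c hx hp hm, map_zero, zero_mul]

/-- for `μ ≠ ν` the `Ω`-restricted cross sum equals the full torus pairing. [folklore] -/
theorem sum_cross_eq_dotProduct {Ω : Finset (Tor N)} (hΩ : CornerFree N Ω) {z : Tor N → ℂ} (hz : SuppIn N Ω z) (c : ℂ)
    {μ ν : Fin d} (hμν : μ ≠ ν) :
    ∑ x ∈ Ω, conj ((Pdir N c μ *ᵥ z) x) * (Pdir N c ν *ᵥ z) x = star (Pdir N c μ *ᵥ z) ⬝ᵥ (Pdir N c ν *ᵥ z) := by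
  rw [Finset.sum_subset (Finset.subset_univ Ω) (fun x _ hx => cross_eq_zero_of_not_mem hΩ hz c hμν hx)]
  rfl

/-! ## §3 The `H²` identity and the regularity inequality -/

/-- the INTERIOR diagonal Hessian energy `H_Ω(z) = Σ_μ Σ_{x∈Ω} |(P_μ z)(x)|²`. [folklore] -/
def Hdiag (c : ℂ) (Ω : Finset (Tor N)) (z : Tor N → ℂ) : ℝ := ∑ μ, ∑ x ∈ Ω, ‖(Pdir N c μ *ᵥ z) x‖ ^ 2

/-- `H_Ω(z) ≥ 0`. [folklore] -/
theorem hdiag_nonneg (c : ℂ) (Ω : Finset (Tor N)) (z : Tor N → ℂ) : 0 ≤ Hdiag c Ω z :=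
  Finset.sum_nonneg fun _ _ => Finset.sum_nonneg fun _ _ => by positivity

/-- the mixed energy `Σ_μ Σ_{ν≠μ} ‖∂_μ∂_ν z‖²`. [folklore] -/
def Hmixed (c : ℂ) (z : Tor N → ℂ) : ℝ := ∑ μ, ∑ ν ∈ univ.erase μ, nsq (sdiff N c μ *ᵥ (sdiff N c ν *ᵥ z))

/-- `Hmixed ≥ 0`. [folklore] -/
theorem hmixed_nonneg (c : ℂ) (z : Tor N → ℂ) : 0 ≤ Hmixed c z :=
  Finset.sum_nonneg fun _ _ => Finset.sum_nonneg fun _ _ => nsq_nonneg _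

/-- **THE DISCRETE `H²` IDENTITY ON A CORNER-FREE REGION**: for `z` supported in `Ω`,
`Σ_{x∈Ω}|(Δz)(x)|² = Σ_μ Σ_{x∈Ω}|(P_μz)(x)|² + Σ_μ Σ_{ν≠μ} ‖∂_μ∂_νz‖²`. [folklore] -/
theorem sum_normSq_LapS_eq {Ω : Finset (Tor N)} (hΩ : CornerFree N Ω) {z : Tor N → ℂ} (hz : SuppIn N Ω z) (c : ℂ) :
    ∑ x ∈ Ω, ‖(LapS N c *ᵥ z) x‖ ^ 2 = Hdiag c Ω z + Hmixed c z := by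
  -- work in `ℂ`
  have key : ((∑ x ∈ Ω, ‖(LapS N c *ᵥ z) x‖ ^ 2 : ℝ) : ℂ) = ((Hdiag c Ω z + Hmixed c z : ℝ) : ℂ) := by
    set a : Fin d → Tor N → ℂ := fun μ => Pdir N c μ *ᵥ z with ha
    have hL : ∀ x, (LapS N c *ᵥ z) x = ∑ μ, a μ x := fun x => LapS_mulVec_eq_sum N c z x
    calc ((∑ x ∈ Ω, ‖(LapS N c *ᵥ z) x‖ ^ 2 : ℝ) : ℂ)
        = ∑ x ∈ Ω, conj ((LapS N c *ᵥ z) x) * (LapS N c *ᵥ z) x := by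
          rw [Complex.ofReal_sum]
          refine Finset.sum_congr rfl fun x _ => ?_
          rw [Complex.conj_mul', Complex.ofReal_pow]
      _ = ∑ x ∈ Ω, ∑ μ, ∑ ν, conj (a μ x) * a ν x := by
          refine Finset.sum_congr rfl fun x _ => ?_
          rw [hL x, map_sum, Finset.sum_mul_sum]
      _ = ∑ μ, ∑ ν, ∑ x ∈ Ω, conj (a μ x) * a ν x := by
          rw [Finset.sum_comm]
          refine Finset.sum_congr rfl fun μ _ => ?_
          rw [Finset.sum_comm]
      _ = ∑ μ, ((∑ x ∈ Ω, conj (a μ x) * a μ x) + ∑ ν ∈ univ.erase μ, ∑ x ∈ Ω, conj (a μ x) * a ν x) := by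
          refine Finset.sum_congr rfl fun μ _ => ?_
          rw [← Finset.add_sum_erase _ _ (Finset.mem_univ μ)]
      _ = ∑ μ, ((∑ x ∈ Ω, ((‖a μ x‖ ^ 2 : ℝ) : ℂ)) +
            ∑ ν ∈ univ.erase μ, ((nsq (sdiff N c μ *ᵥ (sdiff N c ν *ᵥ z)) : ℝ) : ℂ)) := by
          refine Finset.sum_congr rfl fun μ _ => ?_
          congr 1
          · refine Finset.sum_congr rfl fun x _ => ?_
            rw [Complex.conj_mul', Complex.ofReal_pow]
          · refine Finset.sum_congr rfl fun ν hν => ?_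
            rw [ha, sum_cross_eq_dotProduct hΩ hz c (Finset.ne_of_mem_erase hν).symm, star_Pdir_dotProduct_Pdir]
      _ = ((Hdiag c Ω z + Hmixed c z : ℝ) : ℂ) := by
          simp only [Hdiag, Hmixed, Complex.ofReal_add, Complex.ofReal_sum, Finset.sum_add_distrib, ha]
  exact_mod_cast key

/-- **DISCRETE `H²` REGULARITY ON A CORNER-FREE REGION** (constant `1`, uniform in `c = η⁻¹` and in the torus): for `z` supported in
`Ω`, `Σ_μ Σ_{x∈Ω}|(∂_μᴴ∂_μ z)(x)|² ≤ Σ_{x∈Ω}|(Δz)(x)|²` — the interior diagonal second differences are controlled by the COMPRESSED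
Laplacian `ΩΔΩ`. [folklore] -/
theorem hdiag_le_sum_normSq_LapS {Ω : Finset (Tor N)} (hΩ : CornerFree N Ω) {z : Tor N → ℂ} (hz : SuppIn N Ω z) (c : ℂ) :
    Hdiag c Ω z ≤ ∑ x ∈ Ω, ‖(LapS N c *ᵥ z) x‖ ^ 2 := by
  rw [sum_normSq_LapS_eq hΩ hz c]
  exact le_add_of_nonneg_right (hmixed_nonneg c z)

/-- each direction separately: `Σ_{x∈Ω}|(P_μ z)(x)|² ≤ Σ_{x∈Ω}|(Δz)(x)|²`. [folklore] -/
theorem sum_normSq_Pdir_le {Ω : Finset (Tor N)} (hΩ : CornerFree N Ω) {z : Tor N → ℂ} (hz : SuppIn N Ω z) (c : ℂ) (μ : Fin d) :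
    ∑ x ∈ Ω, ‖(Pdir N c μ *ᵥ z) x‖ ^ 2 ≤ ∑ x ∈ Ω, ‖(LapS N c *ᵥ z) x‖ ^ 2 :=
  le_trans (Finset.single_le_sum (f := fun μ => ∑ x ∈ Ω, ‖(Pdir N c μ *ᵥ z) x‖ ^ 2)
    (fun _ _ => Finset.sum_nonneg fun _ _ => by positivity) (Finset.mem_univ μ)) (hdiag_le_sum_normSq_LapS hΩ hz c)

/-! ## §4 Coordinate-product sets are corner-free -/

variable (N)

/-- the coordinate-product set `Π_μ S_μ ⊆ T` (a box of unit blocks when every `S_μ` is an interval of block coordinates; slabs,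
wrapping boxes and products of arbitrary coordinate sets are all allowed). [folklore] -/
def prodSet (S : (μ : Fin d) → Finset (ZMod (N μ))) : Finset (Tor N) := univ.filter fun x => ∀ μ, x μ ∈ S μ

/-- membership in a product set is coordinatewise. [folklore] -/
theorem mem_prodSet {S : (μ : Fin d) → Finset (ZMod (N μ))} {x : Tor N} : x ∈ prodSet N S ↔ ∀ μ, x μ ∈ S μ := by
  simp [prodSet]

omit hN in
/-- moving along `+e_μ` does not change the other coordinates. [folklore] -/
theorem add_unitVec_apply_ne {μ l : Fin d} (h : l ≠ μ) (x : Tor N) : (x + unitVec N μ) l = x l := by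
  simp [unitVec, h]

omit hN in
/-- moving along `−e_μ` does not change the other coordinates. [folklore] -/
theorem sub_unitVec_apply_ne {μ l : Fin d} (h : l ≠ μ) (x : Tor N) : (x - unitVec N μ) l = x l := by
  simp [unitVec, h]

/-- **every coordinate-product set is CORNER-FREE.** [folklore] -/
theorem cornerFree_prodSet (S : (μ : Fin d) → Finset (ZMod (N μ))) : CornerFree N (prodSet N S) := by
  intro x hx μ ν hμν hμ
  -- the `μ`-coordinate of `x` is NOT in `S μ` (all the other coordinates are, by `hμ`)
  have hxμ : x μ ∉ S μ := by
    intro hμS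
    apply hx
    rw [mem_prodSet]
    intro l
    by_cases hl : l = μ
    · subst hl; exact hμS
    · rcases hμ with h | h
      · have := (mem_prodSet N).1 h l
        rwa [add_unitVec_apply_ne N hl] at this
      · have := (mem_prodSet N).1 h l
        rwa [sub_unitVec_apply_ne N hl] at this
  refine ⟨fun h => hxμ ?_, fun h => hxμ ?_⟩
  · have := (mem_prodSet N).1 h μ
    rwa [add_unitVec_apply_ne N hμν] at this
  · have := (mem_prodSet N).1 h μ
    rwa [sub_unitVec_apply_ne N hμν] at this

end Summit.QuantumFields.BalabanUV.Beta.GAN24.DirichletBoxRegularity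

end
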